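import Summits.ValiantsHypothesis.ValiantsHypothesis.Theorems.TwoProducts.RankTwoJacobian
import Mathlib.Data.Finsupp.Lex

/-!
# Rank-two Jacobian, part 2: weights, edge directions, and OSTROWSKI (edge directions of a product) — Lemma 4 in the kernel

`wt` (real weight of an exponent), `IsEdgeDir ν F` (the `ν`-face of `Newt F` carries ≥ 2 support points), the typed `Ostrowski` and its proof
★ `ostrowski : Ostrowski` (`F ≠ 0 → G ≠ 0 → (IsEdgeDir ν (F·G) ↔ IsEdgeDir ν F ∨ IsEdgeDir ν G)`; lexicographic extremes (`Finsupp.Lex`) of the top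
sets: `lexmax + lexmax` and `lexmin + lexmin` have unique support decompositions — `coeff_mul_of_unique`, `decomp_max`, `decomp_min`, `isEdgeDir_mul_left`).

Lift (val-lit-p3 g18, desk #454/#455; critic of record val-idea-crit-8 g3, VERDICT #28 KERNEL ACK + CONTENT GO 03:21:12Z «GO from me on those
statements too») of the FURTHER kernel lemmas of val-idea-35 g9's crux workfile `Cruxes/TwoProducts/RankTwoJacobian_val_idea_35_g9.lean` rev @7f92ff69cb00
(sha16 86ff8e732f9c58b2, 638 l., farm rc 0 / 0 sorry per crit-8) — bodies VERBATIM, namespace `…Cruxes.TwoProducts.ValIdea35g9` →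
`…Theorems.TwoProducts.RankTwoJacobian` (continues ✓ P1 `Theorems/TwoProducts/RankTwoJacobian.lean`: `Poly2`, `emb`, `nv`, `theta`, `jac`, `chainRule`, `jacSupportBound`).
HONEST LABEL: helper lemmas for the SIDE ladder «table-rank-ladder» (K13 K1, VERDICT #26 (U1)) of crux `stmt-ValiantsHypothesis-5906` (`TwoProducts`);
the implication `PortPlan.1` (arc bookkeeping, tower induction, vertex count) and the rank-two composition law are NOT here; nothing closes 5906 /
`PlanarCellBound` / `ResidualLawV25`; VP ≠ VNP is NOT proved.  `--supports stmt-ValiantsHypothesis-5906 --as helper`.  Credit: val-idea-35 g9.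
No instances, no notation, no named facts. [folklore]
-/

noncomputable section
set_option linter.dupNamespace false

namespace Summit.ValiantsHypothesis.ValiantsHypothesis.Theorems.TwoProducts.RankTwoJacobian

open scoped BigOperators Pointwise
open MvPolynomial

/-- `ν`-weight of an exponent. (The `ℝ`-valued twin of `…FormalLogLinearisation.wt` / `PlanarCell.wt` of the 5906 Defs, up to the coercion of exponents — crit-8 g3 naming note.) -/
def wt (ν : Fin 2 → ℝ) (e : Fin 2 →₀ ℕ) : ℝ := ν 0 * ((e 0 : ℕ) : ℝ) + ν 1 * ((e 1 : ℕ) : ℝ)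

/-- `ν` is an (outer) EDGE DIRECTION of `Newt F`: two distinct support points maximise the `ν`-weight
(equivalently `in_ν F` is not a monomial).  `nv F ≤ #edge directions (mod positive scaling) + 1`. -/
def IsEdgeDir (ν : Fin 2 → ℝ) (F : Poly2) : Prop :=
  ∃ p ∈ F.support, ∃ q ∈ F.support, p ≠ q ∧ (∀ r ∈ F.support, wt ν r ≤ wt ν p) ∧ wt ν q = wt ν p

/-- LEMMA 4 (Ostrowski; memo §1): initial forms are multiplicative over a domain, so a product has an edge in direction
`ν` iff one of the factors does. -/
def Ostrowski : Prop :=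
  ∀ (ν : Fin 2 → ℝ) (F G : Poly2), F ≠ 0 → G ≠ 0 → (IsEdgeDir ν (F * G) ↔ IsEdgeDir ν F ∨ IsEdgeDir ν G)

/-! ## Kernel: Lemma 4 (Ostrowski: edge directions of a product), sorry-free
The top `ν`-weight points of `supp (F·G)` are controlled through the lexicographic extremes (`Finsupp.Lex`) of the
top sets of `F` and `G`: `lexmax + lexmax` and `lexmin + lexmin` have unique support decompositions, so their
coefficients are products of nonzero coefficients (no initial-form algebra needed). -/

/-- `wt` is additive. [folklore] -/
theorem wt_add (ν : Fin 2 → ℝ) (a b : Fin 2 →₀ ℕ) : wt ν (a + b) = wt ν a + wt ν b := by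
  simp only [wt, Finsupp.add_apply, Nat.cast_add]; ring

/-- A nonzero polynomial has nonempty support. [folklore] -/
theorem support_nonempty' {F : Poly2} (hF : F ≠ 0) : F.support.Nonempty :=
  Finset.nonempty_of_ne_empty (by rwa [Ne, MvPolynomial.support_eq_empty])

/-- Coefficients vanish off the support. [folklore] -/
theorem coeff_eq_zero_of_not_mem {F : Poly2} {a : Fin 2 →₀ ℕ} (ha : a ∉ F.support) : coeff a F = 0 := by
  simpa [MvPolynomial.mem_support_iff] using ha

/-- Coefficient of a product at a sum with a unique support decomposition. -/
theorem coeff_mul_of_unique (F G : Poly2) (a₀ b₀ : Fin 2 →₀ ℕ)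
    (h : ∀ a ∈ F.support, ∀ b ∈ G.support, a + b = a₀ + b₀ → a = a₀ ∧ b = b₀) :
    coeff (a₀ + b₀) (F * G) = coeff a₀ F * coeff b₀ G := by
  rw [coeff_mul]
  apply Finset.sum_eq_single (a₀, b₀)
  · rintro ⟨a, b⟩ hab hne
    rw [Finset.HasAntidiagonal.mem_antidiagonal] at hab
    by_cases ha : a ∈ F.support
    · by_cases hb : b ∈ G.support
      · obtain ⟨rfl, rfl⟩ := h a ha b hb hab
        exact absurd rfl hne
      · simp only [coeff_eq_zero_of_not_mem hb, mul_zero]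
    · simp only [coeff_eq_zero_of_not_mem ha, zero_mul]
  · intro hn
    exfalso; apply hn
    rw [Finset.HasAntidiagonal.mem_antidiagonal]

/-- The lex-MAX version of the unique-decomposition argument. -/
theorem decomp_max (ν : Fin 2 → ℝ) (F G : Poly2) (p q a₀ b₀ : Fin 2 →₀ ℕ)
    (hpmax : ∀ r ∈ F.support, wt ν r ≤ wt ν p) (hqmax : ∀ r ∈ G.support, wt ν r ≤ wt ν q)
    (ha₀ : wt ν a₀ = wt ν p) (hb₀ : wt ν b₀ = wt ν q)
    (hla : ∀ e ∈ F.support, wt ν e = wt ν p → toLex e ≤ toLex a₀)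
    (hlb : ∀ e ∈ G.support, wt ν e = wt ν q → toLex e ≤ toLex b₀) :
    ∀ a ∈ F.support, ∀ b ∈ G.support, a + b = a₀ + b₀ → a = a₀ ∧ b = b₀ := by
  intro a ha b hb hab
  have hw : wt ν a + wt ν b = wt ν p + wt ν q := by
    rw [← wt_add, hab, wt_add, ha₀, hb₀]
  have hwa : wt ν a = wt ν p := by linarith [hpmax a ha, hqmax b hb]
  have hwb : wt ν b = wt ν q := by linarith [hpmax a ha, hqmax b hb]
  have h1 := hla a ha hwa
  have h2 := hlb b hb hwb
  have hsum : toLex a + toLex b = toLex a₀ + toLex b₀ := by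
    show toLex (a + b) = toLex (a₀ + b₀); rw [hab]
  have haeq : a = a₀ := by
    rcases h1.lt_or_eq with hlt | heq
    · exact absurd hsum (ne_of_lt (add_lt_add_of_lt_of_le hlt h2))
    · exact toLex_inj.mp heq
  refine ⟨haeq, ?_⟩
  rw [haeq] at hab
  exact add_left_cancel hab

/-- The lex-MIN version. -/
theorem decomp_min (ν : Fin 2 → ℝ) (F G : Poly2) (p q a₀ b₀ : Fin 2 →₀ ℕ)
    (hpmax : ∀ r ∈ F.support, wt ν r ≤ wt ν p) (hqmax : ∀ r ∈ G.support, wt ν r ≤ wt ν q)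
    (ha₀ : wt ν a₀ = wt ν p) (hb₀ : wt ν b₀ = wt ν q)
    (hla : ∀ e ∈ F.support, wt ν e = wt ν p → toLex a₀ ≤ toLex e)
    (hlb : ∀ e ∈ G.support, wt ν e = wt ν q → toLex b₀ ≤ toLex e) :
    ∀ a ∈ F.support, ∀ b ∈ G.support, a + b = a₀ + b₀ → a = a₀ ∧ b = b₀ := by
  intro a ha b hb hab
  have hw : wt ν a + wt ν b = wt ν p + wt ν q := by
    rw [← wt_add, hab, wt_add, ha₀, hb₀]
  have hwa : wt ν a = wt ν p := by linarith [hpmax a ha, hqmax b hb]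
  have hwb : wt ν b = wt ν q := by linarith [hpmax a ha, hqmax b hb]
  have h1 := hla a ha hwa
  have h2 := hlb b hb hwb
  have hsum : toLex a₀ + toLex b₀ = toLex a + toLex b := by
    show toLex (a₀ + b₀) = toLex (a + b); rw [hab]
  have haeq : a = a₀ := by
    rcases h1.lt_or_eq with hlt | heq
    · exact absurd hsum (ne_of_lt (add_lt_add_of_lt_of_le hlt h2))
    · exact (toLex_inj.mp heq).symm
  refine ⟨haeq, ?_⟩
  rw [haeq] at hab
  exact add_left_cancel hab

/-- An edge of `F` survives multiplication by any `G ≠ 0` (half of Ostrowski). -/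
theorem isEdgeDir_mul_left (ν : Fin 2 → ℝ) (F G : Poly2) (hG : G ≠ 0) (hFe : IsEdgeDir ν F) :
    IsEdgeDir ν (F * G) := by
  obtain ⟨p, hp, p', hp', hpp', hpmax, hwp'⟩ := hFe
  obtain ⟨q, hq, hqmax⟩ := Finset.exists_max_image G.support (wt ν) (support_nonempty' hG)
  set TF := F.support.filter (fun e => wt ν e = wt ν p) with hTF
  set TG := G.support.filter (fun e => wt ν e = wt ν q) with hTG
  have hpTF : p ∈ TF := Finset.mem_filter.mpr ⟨hp, rfl⟩
  have hp'TF : p' ∈ TF := Finset.mem_filter.mpr ⟨hp', hwp'⟩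
  have hqTG : q ∈ TG := Finset.mem_filter.mpr ⟨hq, rfl⟩
  obtain ⟨aM, haM, haMmax⟩ := Finset.exists_max_image TF (fun e => toLex e) ⟨p, hpTF⟩
  obtain ⟨am, ham, hammin⟩ := Finset.exists_min_image TF (fun e => toLex e) ⟨p, hpTF⟩
  obtain ⟨bM, hbM, hbMmax⟩ := Finset.exists_max_image TG (fun e => toLex e) ⟨q, hqTG⟩
  obtain ⟨bm, hbm, hbmmin⟩ := Finset.exists_min_image TG (fun e => toLex e) ⟨q, hqTG⟩
  have haM' := Finset.mem_filter.mp haM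
  have ham' := Finset.mem_filter.mp ham
  have hbM' := Finset.mem_filter.mp hbM
  have hbm' := Finset.mem_filter.mp hbm
  -- aM ≠ am because TF has the two elements p ≠ p'
  have hlt_a : toLex am < toLex aM := by
    rcases (hammin p hpTF).lt_or_eq with h1 | h1
    · exact lt_of_lt_of_le h1 (haMmax p hpTF)
    · rcases (hammin p' hp'TF).lt_or_eq with h2 | h2
      · exact lt_of_lt_of_le h2 (haMmax p' hp'TF)
      · exact absurd (toLex_inj.mp (h1.symm.trans h2)) hpp'
  have hle_b : toLex bm ≤ toLex bM := (hbmmin q hqTG).trans (hbMmax q hqTG)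
  -- unique decompositions
  have hdecM := decomp_max ν F G p q aM bM hpmax hqmax haM'.2 hbM'.2
    (fun e he hwe => haMmax e (Finset.mem_filter.mpr ⟨he, hwe⟩))
    (fun e he hwe => hbMmax e (Finset.mem_filter.mpr ⟨he, hwe⟩))
  have hdecm := decomp_min ν F G p q am bm hpmax hqmax ham'.2 hbm'.2
    (fun e he hwe => hammin e (Finset.mem_filter.mpr ⟨he, hwe⟩))
    (fun e he hwe => hbmmin e (Finset.mem_filter.mpr ⟨he, hwe⟩))
  have hsM : aM + bM ∈ (F * G).support := by
    rw [MvPolynomial.mem_support_iff, coeff_mul_of_unique F G aM bM hdecM]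
    exact mul_ne_zero (MvPolynomial.mem_support_iff.mp haM'.1) (MvPolynomial.mem_support_iff.mp hbM'.1)
  have hsm : am + bm ∈ (F * G).support := by
    rw [MvPolynomial.mem_support_iff, coeff_mul_of_unique F G am bm hdecm]
    exact mul_ne_zero (MvPolynomial.mem_support_iff.mp ham'.1) (MvPolynomial.mem_support_iff.mp hbm'.1)
  have hne : aM + bM ≠ am + bm := by
    intro h
    have h' : toLex aM + toLex bM = toLex am + toLex bm := by
      show toLex (aM + bM) = toLex (am + bm); rw [h]
    exact absurd h'.symm (ne_of_lt (add_lt_add_of_lt_of_le hlt_a hle_b))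
  refine ⟨aM + bM, hsM, am + bm, hsm, hne, ?_, ?_⟩
  · intro r hr
    obtain ⟨a, ha, b, hb, rfl⟩ := Finset.mem_add.mp (MvPolynomial.support_mul F G hr)
    rw [wt_add, wt_add, haM'.2, hbM'.2]
    linarith [hpmax a ha, hqmax b hb]
  · rw [wt_add, wt_add, haM'.2, hbM'.2, ham'.2, hbm'.2]

/-- **LEMMA 4 in the kernel** (Ostrowski): over the domain `ℂ`, `ν` is an edge direction of `F·G` iff it is one
of `F` or of `G`. -/
theorem ostrowski : Ostrowski := by
  intro ν F G hF hG
  constructor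
  · intro hFG
    by_contra hnot
    push Not at hnot
    obtain ⟨hnF, hnG⟩ := hnot
    obtain ⟨p, hp, hpmax⟩ := Finset.exists_max_image F.support (wt ν) (support_nonempty' hF)
    obtain ⟨q, hq, hqmax⟩ := Finset.exists_max_image G.support (wt ν) (support_nonempty' hG)
    have huF : ∀ a ∈ F.support, wt ν a = wt ν p → a = p := by
      intro a ha hwa
      by_contra hne
      exact hnF ⟨p, hp, a, ha, fun h => hne h.symm, hpmax, hwa⟩
    have huG : ∀ b ∈ G.support, wt ν b = wt ν q → b = q := by
      intro b hb hwb
      by_contra hne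
      exact hnG ⟨q, hq, b, hb, fun h => hne h.symm, hqmax, hwb⟩
    have hdec : ∀ a ∈ F.support, ∀ b ∈ G.support, wt ν (a + b) = wt ν (p + q) → a = p ∧ b = q := by
      intro a ha b hb hw
      rw [wt_add, wt_add] at hw
      have hwa : wt ν a = wt ν p := by linarith [hpmax a ha, hqmax b hb]
      have hwb : wt ν b = wt ν q := by linarith [hpmax a ha, hqmax b hb]
      exact ⟨huF a ha hwa, huG b hb hwb⟩
    have hpq : p + q ∈ (F * G).support := by
      rw [MvPolynomial.mem_support_iff, coeff_mul_of_unique F G p q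
        (fun a ha b hb he => hdec a ha b hb (by rw [he]))]
      exact mul_ne_zero (MvPolynomial.mem_support_iff.mp hp) (MvPolynomial.mem_support_iff.mp hq)
    obtain ⟨r, hr, r', hr', hne, hrmax, hwr'⟩ := hFG
    have key : ∀ s ∈ (F * G).support, wt ν s = wt ν r → s = p + q := by
      intro s hs hws
      obtain ⟨a, ha, b, hb, rfl⟩ := Finset.mem_add.mp (MvPolynomial.support_mul F G hs)
      have hle : wt ν (p + q) ≤ wt ν r := hrmax _ hpq
      have hge : wt ν (a + b) ≤ wt ν (p + q) := by
        rw [wt_add, wt_add]; linarith [hpmax a ha, hqmax b hb]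
      have hab := hdec a ha b hb (by linarith)
      rw [hab.1, hab.2]
    exact hne ((key r hr rfl).trans (key r' hr' hwr').symm)
  · rintro (hFe | hGe)
    · exact isEdgeDir_mul_left ν F G hG hFe
    · rw [mul_comm]; exact isEdgeDir_mul_left ν G F hF hGe



end Summit.ValiantsHypothesis.ValiantsHypothesis.Theorems.TwoProducts.RankTwoJacobian

end
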